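import Literature.NumberTheory.Automorphic.StrongArtinGL2GlobalQuotientProofs
import HarnessLib

/-!
# Gelbart's Prop. 4.1: local rigidity without the genericity hypothesis
(pure proofs; companion to `Automorphic/StrongArtinGL2LocalRigidityProofs` and
`Automorphic/StrongArtinGL2GlobalQuotientProofs`)

`StrongArtinGL2LocalRigidityProofs.frobSatake_of_local_identity` derives Prop. 4.1 at a place `v`
(`σ` unramified at `v`, `charpoly σ(Frob_v) = ∏_{a ∈ α} (X - a)`) from the single-place identity
(12.5.1) of Jacquet–Langlands 1970, p. 210, under the hypothesis that the Satake parameter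
`α = {a₁, a₂}` of `π_v` is *generic*, `aᵢ ≠ q aⱼ` — the hypothesis under which the zeros of the
dual factor `L(1 - s, π̃_v)⁻¹` stay away from those of `L(s, π_v)⁻¹`.  Jacquet–Langlands (p. 211)
need no such hypothesis: they compare *all* zeros and poles of the two sides of (12.5.1), those of
the dual Artin factor `L(1 - s, σ̃_v)` included, and use that the Frobenius eigenvalues of an Artin
representation have absolute value `1`.  This file carries that out:

* `eulerTerm_one_sub` — the dual Euler term is an Euler term up to a unit:
  `1 - c q^{-(1-s)} = -c q^{s-1} (1 - (q/c) q^{-s})`.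
* `eq_pair_of_eulerTerm_identity_of_norm_eq_one` — **rigidity with the dual factors** (the
  zero/pole comparison of Jacquet–Langlands p. 211 in full): if
  `Ψ(s) ∏_{b' ∈ B'} (1 - (q/b') q^{-s}) (1 - a₁ q^{-s})(1 - a₂ q^{-s}) = Φ(s) ∏_{b ∈ β} (1 - b q^{-s}) (1 - q a₁ q^{-s})(1 - q a₂ q^{-s})`
  off a closed set `E` meeting the zero set of every Euler term in finitely many points, with `Φ, Ψ`
  continuous and non-vanishing off `E`, `aᵢ ≠ 0`, `|b| = |b'| = 1`, `card β ≤ 2`, then `β = {a₁, a₂}`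
  — with **no condition relating `a₁` and `a₂`**.  (The terms `(q/b')` and `(q aᵢ)` are the dual
  factors `L(1 - s, σ̃_v)⁻¹`, `L(1 - s, π̃_v)⁻¹` rewritten by `eulerTerm_one_sub`.)  Proof: membership
  and cancellation as in `eq_pair_of_eulerTerm_identity`, the spurious alternatives `a₁ = q a₂`,
  `q a₁ = q/b'`, … being excluded by absolute values (`|q/b'| = q`, `|b| = 1`, `q > 1`).
* `frobSatake_of_local_identity_of_norm_eq_one` — Prop. 4.1 at `v` from (12.5.1) in the tolerant
  form `Ψ(s) L_v(σ', q^{-(1-s)}) ∏_{a ∈ α} (1 - a q^{-s}) = Φ(s) L_v(σ, q^{-s}) ∏_{a ∈ α} (1 - a⁻¹ q^{-(1-s)})`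
  for *any* second Artin representation `σ'` (the contragredient `σ̃` in the application) and any
  non-zero `α` of cardinality two: no genericity.
The consequences for the global analytic package and for the named fact (no genericity hypothesis
on `α` any more) are drawn in the companion `StrongArtinGL2GlobalQuotientUnitProofs`.

No new definition and no named fact is introduced (D-0026).

## References

* H. Jacquet, R. P. Langlands, *Automorphic Forms on GL(2)*, LNM 114 (1970): proof of Thm. 12.2,
  pp. 210–211 (retypeset ed.), (12.5.1). [JacquetLanglands1970]
* S. Gelbart, *Three lectures on the modularity of `ρ̄_{E,3}` …* (1997): Prop. 4.1. [Gelbart1997]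
* P. Deligne, J.-P. Serre, *Formes modulaires de poids 1*, Ann. Sci. ÉNS (4) 7 (1974): Lemma 4.9.
  [DeligneSerreASENS1974]
-/

noncomputable section

open scoped MatrixGroups NumberField Polynomial
open NumberField IsDedekindDomain Field Polynomial Complex Filter Topology Set
open Literature.NumberTheory.GaloisRepresentations (ArtinRep FramedArtinRep)
open Literature.NumberTheory.LFunctions

namespace Literature.NumberTheory.Automorphic

/-! ### Dual Euler terms -/

section Analytic

variable {q : ℕ}

/-- **The dual Euler term is an Euler term up to a unit**:
`1 - c q^{-(1-s)} = -c q^{s-1} · (1 - (q/c) q^{-s})` (`c ≠ 0`, `q ≠ 0`); the unit `-c q^{s-1}` is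
entire and nowhere zero, so the zeros of `L(1 - s, ·)⁻¹`-factors enter the zero/pole comparison of
Jacquet–Langlands 1970, p. 211, as those of ordinary Euler terms with roots `q/c`. [folklore] -/
theorem eulerTerm_one_sub (hq : q ≠ 0) {c : ℂ} (hc : c ≠ 0) (s : ℂ) :
    eulerTerm q c (1 - s) = -(c * (q : ℂ) ^ (s - 1)) * eulerTerm q (q / c) s := by
  have hq' : (q : ℂ) ≠ 0 := Nat.cast_ne_zero.mpr hq
  rw [eulerTerm_def, eulerTerm_def, neg_sub]
  have h1 : (q : ℂ) ^ (s - 1) * (q : ℂ) ^ (-s) = (q : ℂ)⁻¹ := by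
    rw [← cpow_add _ _ hq', show s - 1 + -s = (-1 : ℂ) by ring, cpow_neg_one]
  have key : (q : ℂ) / c * (q : ℂ) ^ (-s) * (c * (q : ℂ) ^ (s - 1)) = 1 := by
    calc (q : ℂ) / c * (q : ℂ) ^ (-s) * (c * (q : ℂ) ^ (s - 1))
        = ((q : ℂ) / c * c) * ((q : ℂ) ^ (s - 1) * (q : ℂ) ^ (-s)) := by ring
      _ = (q : ℂ) * (q : ℂ)⁻¹ := by rw [div_mul_eq_mul_div, mul_div_assoc, div_self hc, mul_one, h1]
      _ = 1 := mul_inv_cancel₀ hq'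
  linear_combination (-1 : ℂ) * key

/-- The unit `s ↦ -c q^{s-1}` is continuous. [folklore] -/
theorem continuous_neg_mul_cpow_sub_one (hq : q ≠ 0) (c : ℂ) :
    Continuous fun s : ℂ => -(c * (q : ℂ) ^ (s - 1)) :=
  (continuous_const.mul (Continuous.const_cpow (continuous_id.sub continuous_const)
    (Or.inl (Nat.cast_ne_zero.mpr hq)))).neg

/-- The unit `-c q^{s-1}` does not vanish (`c ≠ 0`, `q ≠ 0`). [folklore] -/
theorem neg_mul_cpow_sub_one_ne_zero (hq : q ≠ 0) {c : ℂ} (hc : c ≠ 0) (s : ℂ) :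
    -(c * (q : ℂ) ^ (s - 1)) ≠ 0 :=
  neg_ne_zero.mpr (mul_ne_zero hc fun h => (Nat.cast_ne_zero.mpr hq) (cpow_eq_zero_iff _ _ |>.mp h).1)

/-- Product form of `eulerTerm_one_sub` over a multiset of non-zero roots:
`∏_{b ∈ B} (1 - b q^{-(1-s)}) = {∏_{b ∈ B} (-b q^{s-1})} · ∏_{b ∈ B} (1 - (q/b) q^{-s})`. [folklore] -/
theorem multiset_prod_eulerTerm_one_sub (hq : q ≠ 0) {B : Multiset ℂ} (hB : (0 : ℂ) ∉ B) (s : ℂ) :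
    (B.map fun b => eulerTerm q b (1 - s)).prod =
      (B.map fun b => -(b * (q : ℂ) ^ (s - 1))).prod * (B.map fun b => eulerTerm q (q / b) s).prod := by
  rw [← Multiset.prod_map_mul]
  refine congrArg _ (Multiset.map_congr rfl fun b hb => ?_)
  exact eulerTerm_one_sub hq (fun h => hB (h ▸ hb)) s

/-- The same for the dual unramified factor `∏_{a ∈ α} (1 - a⁻¹ q^{-(1-s)})`, whose roots become
`q a`. [folklore] -/
theorem multiset_prod_eulerTerm_inv_one_sub (hq : q ≠ 0) {α : Multiset ℂ} (h0 : (0 : ℂ) ∉ α)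
    (s : ℂ) :
    (α.map fun a => eulerTerm q a⁻¹ (1 - s)).prod =
      (α.map fun a => -(a⁻¹ * (q : ℂ) ^ (s - 1))).prod *
        (α.map fun a => eulerTerm q (q * a) s).prod := by
  rw [← Multiset.prod_map_mul]
  refine congrArg _ (Multiset.map_congr rfl fun a ha => ?_)
  have ha0 : a ≠ 0 := fun h => h0 (h ▸ ha)
  rw [eulerTerm_one_sub hq (inv_ne_zero ha0) s, div_inv_eq_mul]

/-- The unit `∏_{b ∈ B} (-b q^{s-1})` is continuous in `s`. [folklore] -/
theorem continuous_multiset_prod_neg_mul_cpow (hq : q ≠ 0) (B : Multiset ℂ) :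
    Continuous fun s : ℂ => (B.map fun b => -(b * (q : ℂ) ^ (s - 1))).prod :=
  continuous_multiset_prod B fun b _ => continuous_neg_mul_cpow_sub_one hq b

/-- The unit `∏_{b ∈ B} (-b q^{s-1})` does not vanish (`0 ∉ B`). [folklore] -/
theorem multiset_prod_neg_mul_cpow_ne_zero (hq : q ≠ 0) {B : Multiset ℂ} (hB : (0 : ℂ) ∉ B)
    (s : ℂ) : (B.map fun b => -(b * (q : ℂ) ^ (s - 1))).prod ≠ 0 :=
  Multiset.prod_ne_zero fun h => by
    obtain ⟨b, hb, hb0⟩ := Multiset.mem_map.mp h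
    exact neg_mul_cpow_sub_one_ne_zero hq (fun h0 => hB (h0 ▸ hb)) s hb0

/-! ### Rigidity with the dual factors (Jacquet–Langlands p. 211, no genericity) -/

/-- **Rigidity of one Euler factor, with the dual factors and no genericity** (the zero/pole
comparison of Jacquet–Langlands 1970, proof of Thm. 12.2, p. 211, in full).  Let `q > 1`,
`a₁, a₂ ≠ 0`, `β` and `B'` multisets of complex numbers of absolute value `1` with `card β ≤ 2`,
`E ⊆ ℂ` closed and meeting the zero set of every Euler term `1 - c q^{-s}` (`c ≠ 0`) in finitely
many points, `Φ, Ψ` continuous and non-vanishing off `E`, and suppose that for all `s ∉ E`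
`Ψ(s) ∏_{b' ∈ B'} (1 - (q/b') q^{-s}) (1 - a₁ q^{-s})(1 - a₂ q^{-s}) = Φ(s) ∏_{b ∈ β} (1 - b q^{-s}) (1 - q a₁ q^{-s})(1 - q a₂ q^{-s})`.
Then `β = {a₁, a₂}`.  Proof: `a₁` is a root on the right (`mem_of_eulerTerm_identity`), i.e.
`a₁ ∈ β` or `a₁ = q a₂`; in the latter case `q a₁` is a root on the left, and absolute values
(`|q/b'| = q`, `|b| = 1`) leave no possibility; so `a₁ ∈ β`.  Cancel `1 - a₁ q^{-s}`
(`eq_of_eulerTerm_mul_eq`) and repeat with `a₂`; count.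
[cite: JacquetLanglands1970, proof of Thm. 12.2, p. 211] -/
theorem eq_pair_of_eulerTerm_identity_of_norm_eq_one (hq : 1 < q) {a₁ a₂ : ℂ} (h₁ : a₁ ≠ 0)
    (h₂ : a₂ ≠ 0) {β B' : Multiset ℂ} (hβ : Multiset.card β ≤ 2) (hβn : ∀ b ∈ β, ‖b‖ = 1)
    (hB'n : ∀ b ∈ B', ‖b‖ = 1) {E : Set ℂ} (hEc : IsClosed E)
    (hEfin : ∀ c : ℂ, c ≠ 0 → {s | s ∈ E ∧ eulerTerm q c s = 0}.Finite)
    {Φ Ψ : ℂ → ℂ} (hΦc : ContinuousOn Φ Eᶜ) (hΨc : ContinuousOn Ψ Eᶜ)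
    (hΦ : ∀ s, s ∉ E → Φ s ≠ 0) (hΨ : ∀ s, s ∉ E → Ψ s ≠ 0)
    (hid : ∀ s, s ∉ E →
      Ψ s * (B'.map fun b => eulerTerm q (q / b) s).prod * (eulerTerm q a₁ s * eulerTerm q a₂ s) =
        Φ s * (β.map fun b => eulerTerm q b s).prod *
          (eulerTerm q (q * a₁) s * eulerTerm q (q * a₂) s)) :
    β = {a₁, a₂} := by
  have hq0 : q ≠ 0 := by omega
  have hq1 : (1 : ℝ) < q := Nat.one_lt_cast.mpr hq
  -- absolute values
  have hnq : ∀ a : ℂ, ‖(q : ℂ) * a‖ = q * ‖a‖ := fun a => by rw [norm_mul, Complex.norm_natCast]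
  have hnd : ∀ b ∈ B', ‖(q : ℂ) / b‖ = q := fun b hb => by
    rw [norm_div, hB'n b hb, div_one, Complex.norm_natCast]
  -- `a ≠ q a`, `a ≠ q (q a)` for `a ≠ 0`
  have hq_ne : ∀ {a : ℂ}, a ≠ 0 → a ≠ (q : ℂ) * a := fun {a} ha h => by
    have h' : (1 : ℂ) * a = (q : ℂ) * a := by rw [one_mul]; exact h
    have h1 : (1 : ℂ) = q := mul_right_cancel₀ ha h'
    norm_cast at h1
    omega
  have hqq_ne : ∀ {a : ℂ}, a ≠ 0 → a ≠ (q : ℂ) * ((q : ℂ) * a) := fun {a} ha h => by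
    have h' : (1 : ℂ) * a = ((q : ℂ) * q) * a := by rw [one_mul, mul_assoc]; exact h
    have h1 : (1 : ℂ) = (q : ℂ) * q := mul_right_cancel₀ ha h'
    norm_cast at h1
    nlinarith
  have hqa₁ : (q : ℂ) * a₁ ≠ 0 := mul_ne_zero (Nat.cast_ne_zero.mpr hq0) h₁
  have hqa₂ : (q : ℂ) * a₂ ≠ 0 := mul_ne_zero (Nat.cast_ne_zero.mpr hq0) h₂
  -- membership on the right: `a₁ ∈ β + {q a₁, q a₂}`, and `a₂` likewise
  have hmemR : ∀ {a a' : ℂ}, a ≠ 0 →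
      (∀ s, s ∉ E → Ψ s * (B'.map fun b => eulerTerm q (q / b) s).prod *
        (eulerTerm q a s * eulerTerm q a' s) =
        Φ s * (β.map fun b => eulerTerm q b s).prod *
          (eulerTerm q (q * a₁) s * eulerTerm q (q * a₂) s)) →
      a ∈ β ∨ a = q * a₁ ∨ a = q * a₂ := by
    intro a a' ha hid'
    have hmem : a ∈ β + {(q : ℂ) * a₁, (q : ℂ) * a₂} :=
      mem_of_eulerTerm_identity hq ha (hEfin a ha) hΦ
        (L := fun s => Ψ s * (B'.map fun b => eulerTerm q (q / b) s).prod * eulerTerm q a' s)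
        fun s hs => by
          have h := hid' s hs
          simp only [Multiset.map_add, Multiset.prod_add, Multiset.insert_eq_cons, Multiset.map_cons,
            Multiset.prod_cons, Multiset.map_singleton, Multiset.prod_singleton]
          linear_combination h
    simp only [Multiset.mem_add, Multiset.insert_eq_cons, Multiset.mem_cons,
      Multiset.mem_singleton] at hmem
    tauto
  -- membership on the left: `q aᵢ ∈ {q/b'} + {a₁, a₂}`
  have hmemL : ∀ {c c' : ℂ}, c ≠ 0 →
      (∀ s, s ∉ E → Ψ s * (B'.map fun b => eulerTerm q (q / b) s).prod *
        (eulerTerm q a₁ s * eulerTerm q a₂ s) =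
        Φ s * (β.map fun b => eulerTerm q b s).prod * (eulerTerm q c s * eulerTerm q c' s)) →
      (∃ b ∈ B', (q : ℂ) / b = c) ∨ c = a₁ ∨ c = a₂ := by
    intro c c' hc hid'
    have hmem : c ∈ (B'.map fun b => (q : ℂ) / b) + {a₁, a₂} :=
      mem_of_eulerTerm_identity hq hc (hEfin c hc) hΨ
        (L := fun s => Φ s * (β.map fun b => eulerTerm q b s).prod * eulerTerm q c' s)
        fun s hs => by
          have h := hid' s hs
          simp only [Multiset.map_add, Multiset.prod_add, Multiset.insert_eq_cons, Multiset.map_cons,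
            Multiset.prod_cons, Multiset.map_singleton, Multiset.prod_singleton, Multiset.map_map,
            Function.comp_def]
          linear_combination -h
    simp only [Multiset.mem_add, Multiset.insert_eq_cons, Multiset.mem_cons,
      Multiset.mem_singleton, Multiset.mem_map] at hmem
    tauto
  -- Step 1: `a₁ ∈ β`
  have hmem₁ : a₁ ∈ β := by
    rcases hmemR h₁ hid with h | h | h
    · exact h
    · exact absurd h (hq_ne h₁)
    · exfalso
      -- `a₁ = q a₂`: then `q a₁` is a root on the left
      rcases hmemL hqa₁ hid with ⟨b, hb, hbq⟩ | h' | h'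
      · -- `|a₁| = 1`, so `|a₂| = 1/q`; but `a₂` is a root on the right
        have hna₁ : ‖a₁‖ = 1 := by
          have := hnd b hb
          rw [hbq, hnq] at this
          have hqpos : (0 : ℝ) < q := by linarith
          field_simp at this
          linarith [this]
        have hna₂ : (q : ℝ) * ‖a₂‖ = 1 := by rw [← hna₁, h, hnq]
        rcases hmemR (a' := a₁) h₂ (fun s hs => by have h' := hid s hs; linear_combination h')
          with h2 | h2 | h2
        · have := hβn a₂ h2
          rw [this, mul_one] at hna₂
          exact absurd (by exact_mod_cast hna₂ : q = 1) (by omega)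
        · rw [h2, hnq, hna₁, mul_one] at hna₂
          nlinarith
        · exact hq_ne h₂ h2
      · exact hq_ne h₁ h'.symm
      · rw [h] at h'
        exact hqq_ne h₂ h'.symm
  obtain ⟨β', rfl⟩ := Multiset.exists_cons_of_mem hmem₁
  -- Step 2: cancel `1 - a₁ q^{-s}`
  have hid' : ∀ s, s ∉ E →
      Ψ s * (B'.map fun b => eulerTerm q (q / b) s).prod * eulerTerm q a₂ s =
        Φ s * (β'.map fun b => eulerTerm q b s).prod *
          (eulerTerm q (q * a₁) s * eulerTerm q (q * a₂) s) := by
    refine eq_of_eulerTerm_mul_eq hq a₁ hEc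
      ((hΨc.mul (continuous_multiset_prod B' fun b _ =>
        continuous_eulerTerm hq0 ((q : ℂ) / b)).continuousOn).mul
        (continuous_eulerTerm hq0 a₂).continuousOn)
      ((hΦc.mul (continuous_multiset_prod_eulerTerm hq0 β').continuousOn).mul
        ((continuous_eulerTerm hq0 _).mul (continuous_eulerTerm hq0 _)).continuousOn)
      fun s hs => ?_
    have h := hid s hs
    rw [Multiset.map_cons, Multiset.prod_cons] at h
    linear_combination h
  -- Step 3: `a₂ ∈ β'`
  have hmem₂ : a₂ ∈ β' := by
    have hmem : a₂ ∈ β' + {(q : ℂ) * a₁, (q : ℂ) * a₂} :=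
      mem_of_eulerTerm_identity hq h₂ (hEfin a₂ h₂) hΦ
        (L := fun s => Ψ s * (B'.map fun b => eulerTerm q (q / b) s).prod)
        fun s hs => by
          have h := hid' s hs
          simp only [Multiset.map_add, Multiset.prod_add, Multiset.insert_eq_cons, Multiset.map_cons,
            Multiset.prod_cons, Multiset.map_singleton, Multiset.prod_singleton]
          linear_combination h
    have hmem' : a₂ ∈ β' ∨ a₂ = q * a₁ ∨ a₂ = q * a₂ := by
      simp only [Multiset.mem_add, Multiset.insert_eq_cons, Multiset.mem_cons,
        Multiset.mem_singleton] at hmem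
      tauto
    rcases hmem' with h | h | h
    · exact h
    · exfalso
      -- `a₂ = q a₁`: then `q a₂` is a root on the left of the cancelled identity
      have hmem'' : (q : ℂ) * a₂ ∈ (B'.map fun b => (q : ℂ) / b) + {a₂} :=
        mem_of_eulerTerm_identity hq hqa₂ (hEfin _ hqa₂) hΨ
          (L := fun s => Φ s * (β'.map fun b => eulerTerm q b s).prod * eulerTerm q (q * a₁) s)
          fun s hs => by
            have h' := hid' s hs
            simp only [Multiset.map_add, Multiset.prod_add, Multiset.map_singleton,
              Multiset.prod_singleton, Multiset.map_map, Function.comp_def]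
            linear_combination -h'
      have hcases : (∃ b ∈ B', (q : ℂ) / b = q * a₂) ∨ (q : ℂ) * a₂ = a₂ := by
        simp only [Multiset.mem_add, Multiset.mem_singleton, Multiset.mem_map] at hmem''
        tauto
      rcases hcases with ⟨b, hb, hbq⟩ | h'
      · have hna₂ : ‖a₂‖ = 1 := by
          have := hnd b hb
          rw [hbq, hnq] at this
          have hqpos : (0 : ℝ) < q := by linarith
          field_simp at this
          linarith [this]
        have hna₁ : ‖a₁‖ = 1 := hβn a₁ (Multiset.mem_cons_self _ _)
        have : ‖a₂‖ = q * ‖a₁‖ := by rw [h, hnq]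
        rw [hna₂, hna₁, mul_one] at this
        exact absurd (by exact_mod_cast this.symm : q = 1) (by omega)
      · exact hq_ne h₂ h'.symm
    · exact absurd h (hq_ne h₂)
  obtain ⟨β'', rfl⟩ := Multiset.exists_cons_of_mem hmem₂
  -- Step 4: count
  have h0 : β'' = 0 := by
    simp only [Multiset.card_cons] at hβ
    exact Multiset.card_eq_zero.mp (by omega)
  subst h0
  rfl

end Analytic

/-! ### Prop. 4.1 at `v` from (12.5.1) with the dual Artin factor, no genericity -/

section Galois

variable {F : Type*} [Field F] [NumberField F]

/-- **Gelbart's Prop. 4.1 at one place from the local identity, without genericity.**  Let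
`σ, σ' : Γ_F → GL₂(ℂ)` be Artin representations (`σ'` is the contragredient `σ̃` in the
application, but any Artin representation will do), `v` a finite place, `q = N v`, `α` a multiset
of two non-zero complex numbers.  Suppose that off a closed set `E ⊆ ℂ` meeting the zero set of
every Euler term in finitely many points, with `Φ, Ψ` continuous and non-vanishing off `E`,
`Ψ(s) · L_v(σ', q^{-(1-s)}) · ∏_{a ∈ α} (1 - a q^{-s}) = Φ(s) · L_v(σ, q^{-s}) · ∏_{a ∈ α} (1 - a⁻¹ q^{-(1-s)})`
(`L_v(ρ, T) = det(1 - T ρ(Frob) | V^{I_v})` = `ArtinRep.eulerFactorAt`), i.e. (12.5.1) of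
Jacquet–Langlands 1970, p. 210, cross-multiplied, with all four local factors at `v` displayed and
everything else (the `ε`-quotient, the archimedean `Γ`-quotients) in `Φ, Ψ`.  Then `σ` is
unramified at `v` and `charpoly σ(Frob_v) = ∏_{a ∈ α} (X - a)`.  Proof: the Frobenius eigenvalues
of `σ` and `σ'` on inertia invariants have absolute value `1`
(`ArtinRep.exists_card_le_eval_eulerFactorAt_eq_prod`); rewrite the two dual factors by
`eulerTerm_one_sub`, apply `eq_pair_of_eulerTerm_identity_of_norm_eq_one`, and conclude by
`isUnramifiedAt_and_hasFrobCharpolyAt_of_eval_eulerFactorAt`.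
[cite: JacquetLanglands1970, proof of Thm. 12.2, pp. 210–211, (12.5.1)] -/
theorem frobSatake_of_local_identity_of_norm_eq_one (σ σ' : FramedArtinRep F 2)
    (v : HeightOneSpectrum (𝓞 F)) {α : Multiset ℂ} (hcard : Multiset.card α = 2)
    (h0 : (0 : ℂ) ∉ α) {E : Set ℂ} (hEc : IsClosed E)
    (hEfin : ∀ c : ℂ, c ≠ 0 → {s | s ∈ E ∧ eulerTerm v.residueCard c s = 0}.Finite)
    {Φ Ψ : ℂ → ℂ} (hΦc : ContinuousOn Φ Eᶜ) (hΨc : ContinuousOn Ψ Eᶜ)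
    (hΦ : ∀ s, s ∉ E → Φ s ≠ 0) (hΨ : ∀ s, s ∉ E → Ψ s ≠ 0)
    (hid : ∀ s, s ∉ E →
      Ψ s * (σ'.toArtinRep.eulerFactorAt v).eval ((v.residueCard : ℂ) ^ (-(1 - s))) *
          (α.map fun a => eulerTerm v.residueCard a s).prod =
        Φ s * (σ.toArtinRep.eulerFactorAt v).eval ((v.residueCard : ℂ) ^ (-s)) *
          (α.map fun a => eulerTerm v.residueCard a⁻¹ (1 - s)).prod) :
    σ.IsUnramifiedAt v ∧ σ.HasFrobCharpolyAt v (satakePolynomial α) := by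
  set q := v.residueCard with hq_def
  have hq : 1 < q := v.one_lt_residueCard
  have hq0 : q ≠ 0 := by omega
  obtain ⟨a₁, a₂, rfl⟩ := Multiset.card_eq_two.mp hcard
  have ha₁ : a₁ ∈ ({a₁, a₂} : Multiset ℂ) := Multiset.mem_cons_self _ _
  have ha₂ : a₂ ∈ ({a₁, a₂} : Multiset ℂ) := by simp
  have h₁ : a₁ ≠ 0 := fun h => h0 (h ▸ ha₁)
  have h₂ : a₂ ≠ 0 := fun h => h0 (h ▸ ha₂)
  -- Frobenius eigenvalues of `σ` and `σ'` on inertia invariants: absolute value `1`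
  obtain ⟨β, hβcard, hβn, hβ⟩ :=
    GaloisRepresentations.ArtinRep.exists_card_le_eval_eulerFactorAt_eq_prod σ.toArtinRep
      (GaloisRepresentations.ArtinRep.finite_range_holds (K := F) (V := Fin 2 → ℂ) σ.toArtinRep) v
  obtain ⟨B', -, hB'n, hB'⟩ :=
    GaloisRepresentations.ArtinRep.exists_card_le_eval_eulerFactorAt_eq_prod σ'.toArtinRep
      (GaloisRepresentations.ArtinRep.finite_range_holds (K := F) (V := Fin 2 → ℂ) σ'.toArtinRep) v
  rw [Module.finrank_fin_fun] at hβcard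
  have hB'0 : (0 : ℂ) ∉ B' := fun h => by simpa using hB'n 0 h
  -- the units coming from the two dual factors
  set UB : ℂ → ℂ := fun s => (B'.map fun b => -(b * (q : ℂ) ^ (s - 1))).prod with hUB
  set UA : ℂ → ℂ := fun s =>
    (({a₁, a₂} : Multiset ℂ).map fun a => -(a⁻¹ * (q : ℂ) ^ (s - 1))).prod with hUA
  have hUBc : Continuous UB := continuous_multiset_prod_neg_mul_cpow hq0 B'
  have hUAc : Continuous UA := by
    have h := continuous_multiset_prod_neg_mul_cpow hq0 (({a₁, a₂} : Multiset ℂ).map fun a => a⁻¹)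
    simp only [Multiset.map_map, Function.comp_def] at h
    exact h
  have hUB0 : ∀ s, UB s ≠ 0 := fun s => multiset_prod_neg_mul_cpow_ne_zero hq0 hB'0 s
  have hUA0 : ∀ s, UA s ≠ 0 := fun s => by
    have h0' : (0 : ℂ) ∉ (({a₁, a₂} : Multiset ℂ).map fun a => a⁻¹) := fun h => by
      obtain ⟨a, ha, ha0⟩ := Multiset.mem_map.mp h
      exact h0 ((inv_eq_zero.mp ha0) ▸ ha)
    have h := multiset_prod_neg_mul_cpow_ne_zero hq0 h0' s
    simpa only [Multiset.map_map, Function.comp_def] using h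
  -- the converted identity
  have hid' : ∀ s, s ∉ E →
      (Ψ s * UB s) * (B'.map fun b => eulerTerm q (q / b) s).prod *
          (eulerTerm q a₁ s * eulerTerm q a₂ s) =
        (Φ s * UA s) * (β.map fun b => eulerTerm q b s).prod *
          (eulerTerm q (q * a₁) s * eulerTerm q (q * a₂) s) := by
    intro s hs
    have h := hid s hs
    have hσ' : (σ'.toArtinRep.eulerFactorAt v).eval ((q : ℂ) ^ (-(1 - s))) =
        UB s * (B'.map fun b => eulerTerm q (q / b) s).prod := by
      rw [hB', ← multiset_prod_eulerTerm_one_sub hq0 hB'0 s]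
      simp only [eulerTerm_def]
    have hπ' : (({a₁, a₂} : Multiset ℂ).map fun a => eulerTerm q a⁻¹ (1 - s)).prod =
        UA s * (eulerTerm q (q * a₁) s * eulerTerm q (q * a₂) s) := by
      rw [multiset_prod_eulerTerm_inv_one_sub hq0 h0 s]
      simp only [hUA, Multiset.insert_eq_cons, Multiset.map_cons, Multiset.prod_cons,
        Multiset.map_singleton, Multiset.prod_singleton]
    rw [hσ', hπ', hβ] at h
    simp only [Multiset.insert_eq_cons, Multiset.map_cons, Multiset.prod_cons,
      Multiset.map_singleton, Multiset.prod_singleton] at h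
    simp only [eulerTerm_def] at h ⊢
    linear_combination h
  have hβeq : β = {a₁, a₂} :=
    eq_pair_of_eulerTerm_identity_of_norm_eq_one hq h₁ h₂ hβcard hβn hB'n hEc hEfin
      ((hΦc.mul hUAc.continuousOn)) ((hΨc.mul hUBc.continuousOn))
      (fun s hs => mul_ne_zero (hΦ s hs) (hUA0 s)) (fun s hs => mul_ne_zero (hΨ s hs) (hUB0 s)) hid'
  refine isUnramifiedAt_and_hasFrobCharpolyAt_of_eval_eulerFactorAt σ v hcard h0 fun z => ?_
  rw [hβ z, hβeq]

end Galois

end Literature.NumberTheory.Automorphic
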